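import Summits.ValiantsHypothesis.ValiantsHypothesis.Theorems.BarrierLeverPartitionMinorsHitByVPSplittableFacesMirror

/-!
# Route BarrierLever — item `PartitionMinorsHitByVP` (stmt-ValiantsHypothesis-19717):
# the GENERIC-NONSINGULARITY statement for the subset-sum Vandermonde (definition + bridges)

Helper / definitions file (`--supports stmt-ValiantsHypothesis-19717`; cell valiant-natproofs, rung V4, 𝒟-side
door (c); prover seat val-np-p3 gen 5, the «ESL / defect-criterion» owner after director-valiant g6's rulings
2026-08-27T06:51Z (B) and 08:12:31Z (3): killable conjectures of the subset-sum line live Theorems-side as ONE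
`def … : Prop` plus kernel bridges and a finite falsifier, never as route items). Closes NO item.

**Context.** The additive / subset-sum witness (doors p506404 `AdditiveDoor.partitionMinor_hit_of_additive_mem`,
engine p507703 `SubsetSum.det_ssv_ne_zero`) hits the layout «`2^κ` arbitrary rows × a `κ`-dimensional FACE of
columns» of item 19717 as soon as the symbolic subset-sum Vandermonde `ssv κ u` of the row family `u` has
nonzero determinant. The tree proves this for `IsSplittable` families (recursive hyperplane HALVING) and states the
all-rows version conditionally on `CubeHalving` (`partitionMinor_hit_face_of_cubeHalving`, p510577). But
`CubeHalving 7 6` is FALSE (val-np-p3 g4, 2026-08-27T08:13Z: a 64-subset of `{0,1}^7` with no halving hyperplane;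
z3 unsat, kit j273103), so that hypothesis is vacuous from `κ = 6`, `h ≥ 7` — while the determinant itself is
nonzero on the same family and on every family tested since.

**This file.**
* `SubsetSum.GenericNonsingular h κ` — THE statement the door needs, as a `def`: for every injective family
  `u : (Fin κ → Bool) → Finset (Fin h)` of `2^κ` rows, `det (ssv κ u) ≠ 0` in `ℂ[X_(c,none), X_(c,some k)]`
  (equivalently — `genericNonsingular_iff_table` — some NUMERIC table `Γ₀, Γ` makes the multilinear Vandermonde at
  the subset-sum points nonsingular). No theorem asserts it. EVIDENCE (val-np-p3 g5 memo
  `MEMO-GEN-beyond-halving-valnp3-g5.md` on item 19717; kit j273918 / j274343, exact mod-p determinants at random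
  tables): 0 failures among random DENSE families (`2^κ = 2^(h-1)`) at `h = 8` (2 200 families), `9` (460), `10`
  (116), `11` (28), `12` (8), random families with `κ = h-2, h-3, h-4` up to `h = 12`, and structured dense families
  (weight thresholds, bent supports, down-sets, majority cells) for `h = 7…12` — almost all of which are NOT
  hyperplane-halvable. The memo also proves that every «exact-section» certificate in the last functional reduces
  to hyperplane halving (so no refinement of `IsSplittable` of that kind can reach these families) and records the
  sharper working conjecture M′ (multiplier transversality; exhaustive at `(h,κ) = (4,3)`, kit j274342).
* `genericNonsingular_of_isSplittable_all`, `genericNonsingular_of_cubeHalving` — the old hypotheses imply the new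
  one (so nothing proved so far is lost), `genericNonsingular_zero`.
* `genericNonsingular_iff_table` — symbolic ⇔ numeric (`MvPolynomial.funext` / the evaluation ring map).
* **`partitionMinor_hit_face_of_genericNonsingular`** (+ `_fin` in the item's quantifier shape, + the x↔y mirror
  `partitionMinor_hit_of_face_genericNonsingular`): `GenericNonsingular h κ` ⇒ every injective family of `2^κ` rows
  against a `κ`-face of columns `[W₀, W₀ ⊔ T]` is hit inside `SmallCircuits ℂ (h+h) 5` (`h ≥ 2`). This is the honest
  conditional of record for the «all rows × face columns» class; its hypothesis is the object the cell's numerics test.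

WHAT THIS IS NOT: no proof of `GenericNonsingular h κ` for any `κ ≥ 1` beyond the splittable case; nothing on
coordinate-halvable columns (engine v2), CPM 20172/20195, crux 14610, or VP vs VNP.
-/

set_option linter.dupNamespace false

namespace Summit.ValiantsHypothesis.ValiantsHypothesis.Theorems.BarrierLever.SubsetSum

open Finset MvPolynomial Matrix

noncomputable section

variable {h : ℕ}

/-! ## 1. The statement -/

/-- **GENERIC NONSINGULARITY of the subset-sum multilinear Vandermonde** at height `h`, size `2^κ`: for every
injective family `u` of `2^κ` subsets of `Fin h` (indexed by bit-vectors), the symbolic matrix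
`ssv κ u = [∏_{c : W c} (X_(c,none) + Σ_{k ∈ u i} X_(c,some k))]_{i,W}` has nonzero determinant in the polynomial
ring `R κ h`. Conjectured for all `h, κ` (numerics to `h = 12`, see the module docstring); proved in the tree for
splittable families (`det_ssv_ne_zero`). Typed as a definition only — NO theorem asserts it. -/
def GenericNonsingular (h κ : ℕ) : Prop :=
  ∀ u : (Fin κ → Bool) → Finset (Fin h), Function.Injective u → (ssv κ u).det ≠ 0

/-! ## 2. Symbolic ⇔ numeric -/

/-- A nonzero symbolic determinant has a nonsingular NUMERIC specialisation: some table `Γ₀, Γ` makes the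
multilinear Vandermonde at the subset-sum points `Γ₀ + Σ_{k ∈ u i} Γ k` nonsingular. -/
theorem exists_table_of_det_ssv_ne_zero (κ : ℕ) (u : (Fin κ → Bool) → Finset (Fin h))
    (hne : (ssv κ u).det ≠ 0) :
    ∃ (Γ₀ : Fin κ → ℂ) (Γ : Fin h → Fin κ → ℂ),
      (Matrix.of fun i W : Fin κ → Bool =>
        ∏ c : Fin κ, if W c then (Γ₀ c + ∑ k ∈ u i, Γ k c) else (1 : ℂ)).det ≠ 0 := by
  have : ∃ x : Fin κ × Option (Fin h) → ℂ, eval x (ssv κ u).det ≠ 0 := by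
    by_contra hcon
    push Not at hcon
    exact hne (MvPolynomial.funext fun x => by rw [hcon x, map_zero])
  obtain ⟨x, hx⟩ := this
  refine ⟨fun c => x (c, none), fun k c => x (c, some k), ?_⟩
  rw [RingHom.map_det] at hx
  convert hx using 2
  ext i W
  simp only [Matrix.of_apply, RingHom.mapMatrix_apply, Matrix.map_apply, ssv, map_prod]
  refine Finset.prod_congr rfl fun c _ => ?_
  split_ifs
  · simp [lin, map_add, map_sum, eval_X]
  · simp

/-- Conversely a nonsingular numeric table forces the symbolic determinant to be nonzero (evaluation is a ring
map, so it cannot send `0` to a nonzero determinant). -/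
theorem det_ssv_ne_zero_of_table (κ : ℕ) (u : (Fin κ → Bool) → Finset (Fin h))
    (Γ₀ : Fin κ → ℂ) (Γ : Fin h → Fin κ → ℂ)
    (hdet : (Matrix.of fun i W : Fin κ → Bool =>
      ∏ c : Fin κ, if W c then (Γ₀ c + ∑ k ∈ u i, Γ k c) else (1 : ℂ)).det ≠ 0) :
    (ssv κ u).det ≠ 0 := by
  intro hzero
  -- evaluate at the point reading off the table
  let x : Fin κ × Option (Fin h) → ℂ := fun p => Option.elim p.2 (Γ₀ p.1) (fun k => Γ k p.1)
  have hx : eval x (ssv κ u).det = 0 := by rw [hzero, map_zero]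
  rw [RingHom.map_det] at hx
  apply hdet
  convert hx using 2
  ext i W
  simp only [Matrix.of_apply, RingHom.mapMatrix_apply, Matrix.map_apply, ssv, map_prod]
  refine Finset.prod_congr rfl fun c _ => ?_
  split_ifs
  · simp [lin, map_add, map_sum, eval_X, x]
  · simp

/-- **Symbolic ⇔ numeric.** `GenericNonsingular h κ` holds iff every injective `2^κ`-family of rows admits a
numeric table `Γ₀, Γ` with nonsingular multilinear Vandermonde at its subset-sum points — literally the hypothesis
of `AdditiveDoor.partitionMinor_hit_of_additive_mem` on a face of columns. -/
theorem genericNonsingular_iff_table (h κ : ℕ) :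
    GenericNonsingular h κ ↔
      ∀ u : (Fin κ → Bool) → Finset (Fin h), Function.Injective u →
        ∃ (Γ₀ : Fin κ → ℂ) (Γ : Fin h → Fin κ → ℂ),
          (Matrix.of fun i W : Fin κ → Bool =>
            ∏ c : Fin κ, if W c then (Γ₀ c + ∑ k ∈ u i, Γ k c) else (1 : ℂ)).det ≠ 0 := by
  constructor
  · intro H u hu
    exact exists_table_of_det_ssv_ne_zero κ u (H u hu)
  · intro H u hu
    obtain ⟨Γ₀, Γ, hdet⟩ := H u hu
    exact det_ssv_ne_zero_of_table κ u Γ₀ Γ hdet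

/-! ## 3. What the tree already gives -/

/-- Depth `0`: a single row; the `1 × 1` matrix `[1]`. -/
theorem genericNonsingular_zero (h : ℕ) : GenericNonsingular h 0 := by
  intro u hu
  refine det_ssv_ne_zero 0 u hu ?_
  -- a one-element family is splittable of depth 0
  have hcard : (univ.image u).card = 1 := by
    rw [Finset.card_image_of_injective _ hu, Finset.card_univ, card_bv, pow_zero]
  unfold IsSplittable
  exact hcard

/-- If EVERY injective `2^κ`-family at height `h` is splittable, `GenericNonsingular h κ` holds (engine p507703). -/
theorem genericNonsingular_of_isSplittable_all {κ : ℕ}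
    (H : ∀ u : (Fin κ → Bool) → Finset (Fin h), Function.Injective u → IsSplittable κ (univ.image u)) :
    GenericNonsingular h κ :=
  fun u hu => det_ssv_ne_zero κ u hu (H u hu)

/-- **CUBE HALVING ⇒ GENERIC NONSINGULARITY**: the old conditional hypothesis implies the new one
(via `isSplittable_of_cubeHalving`). Note `CubeHalving 7 6` is false, so this is informative only for small `κ`. -/
theorem genericNonsingular_of_cubeHalving {κ : ℕ} (H : ∀ κ' ≤ κ, CubeHalving h κ') :
    GenericNonsingular h κ := by
  refine genericNonsingular_of_isSplittable_all fun u hu => ?_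
  refine isSplittable_of_cubeHalving κ H _ ?_
  rw [Finset.card_image_of_injective _ hu, Finset.card_univ, card_bv]

/-! ## 4. Through the door: all rows × face columns, conditional on `GenericNonsingular` -/

open Literature.Barriers.ValiantsHypothesis
open Summit.ValiantsHypothesis.ValiantsHypothesis.Theorems.BarrierLever.AdditiveDoor
  (partitionMinor_hit_of_additive_mem partitionMinor_hit_symm)

/-- **ALL rows × face columns, conditional on GENERIC NONSINGULARITY** (bit-vector-indexed form): if
`GenericNonsingular h κ`, every injective family `u` of `2^κ` rows against the face `[W₀, W₀ ⊔ T]` of columns is hit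
inside `SmallCircuits ℂ (h+h) 5` (`h ≥ 2`). -/
theorem partitionMinor_hit_face_of_genericNonsingular (hh : 2 ≤ h) {κ : ℕ} (H : GenericNonsingular h κ)
    (u : (Fin κ → Bool) → Finset (Fin h)) (hu : Function.Injective u)
    (T : Fin κ ↪ Fin h) (W₀ : Finset (Fin h)) (hW₀ : ∀ c, T c ∉ W₀) :
    ∃ f ∈ SmallCircuits ℂ (h + h) 5,
      (Matrix.of fun i j : Fin κ → Bool => MvPolynomial.coeff
        (∑ a ∈ u i, Finsupp.single (Fin.castAdd h a) 1 +
          ∑ c ∈ W₀ ∪ (univ.filter fun c => j c).map T, Finsupp.single (Fin.natAdd h c) 1) f).det ≠ 0 := by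
  obtain ⟨Γ₀, Γ, hdet⟩ := exists_table_of_det_ssv_ne_zero κ u (H u hu)
  refine partitionMinor_hit_of_additive_mem h hh u (fun j => W₀ ∪ (univ.filter fun c => j c).map T)
    (Function.extend T Γ₀ fun _ => 1) (fun k => Function.extend T (Γ k) fun _ => 0) ?_
  have hmat : (Matrix.of fun i j : Fin κ → Bool => ∏ c ∈ W₀ ∪ (univ.filter fun c => j c).map T,
        (Function.extend T Γ₀ (fun _ => (1 : ℂ)) c +
          ∑ k ∈ u i, Function.extend T (Γ k) (fun _ => (0 : ℂ)) c)) =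
      Matrix.of fun i j : Fin κ → Bool => ∏ c : Fin κ, if j c then (Γ₀ c + ∑ k ∈ u i, Γ k c) else 1 := by
    ext i j
    exact prod_face_extend T W₀ hW₀ Γ₀ Γ (u i) j
  rw [hmat]
  exact hdet

/-- **ALL rows × face columns, conditional on GENERIC NONSINGULARITY** (`Fin r`-indexed form, the item's
quantifier shape): rows `u : Fin r → Finset (Fin h)` injective, columns `w j = W₀ ∪ T(e j)` along a bijection
`e : Fin r ≃ (Fin κ → Bool)`. -/
theorem partitionMinor_hit_face_of_genericNonsingular_fin (hh : 2 ≤ h) {κ r : ℕ} (H : GenericNonsingular h κ)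
    (e : Fin r ≃ (Fin κ → Bool)) (u w : Fin r → Finset (Fin h)) (hu : Function.Injective u)
    (T : Fin κ ↪ Fin h) (W₀ : Finset (Fin h)) (hW₀ : ∀ c, T c ∉ W₀)
    (hw : ∀ j, w j = W₀ ∪ (univ.filter fun c => e j c).map T) :
    ∃ f ∈ SmallCircuits ℂ (h + h) 5,
      (Matrix.of fun i j : Fin r => MvPolynomial.coeff
        (∑ a ∈ u i, Finsupp.single (Fin.castAdd h a) 1 +
          ∑ c ∈ w j, Finsupp.single (Fin.natAdd h c) 1) f).det ≠ 0 := by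
  have hu' : Function.Injective (fun i : Fin κ → Bool => u (e.symm i)) :=
    fun i j hij => e.symm.injective (hu hij)
  obtain ⟨f, hf, hdet⟩ := partitionMinor_hit_face_of_genericNonsingular hh H (fun i => u (e.symm i)) hu' T W₀ hW₀
  refine ⟨f, hf, ?_⟩
  have hmat : (Matrix.of fun i j : Fin r => MvPolynomial.coeff
        (∑ a ∈ u i, Finsupp.single (Fin.castAdd h a) 1 +
          ∑ c ∈ w j, Finsupp.single (Fin.natAdd h c) 1) f) =
      (Matrix.of fun i j : Fin κ → Bool => MvPolynomial.coeff
        (∑ a ∈ u (e.symm i), Finsupp.single (Fin.castAdd h a) 1 +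
          ∑ c ∈ W₀ ∪ (univ.filter fun c => j c).map T, Finsupp.single (Fin.natAdd h c) 1) f).submatrix
        e e := by
    ext i j
    simp [Matrix.submatrix_apply, hw j]
  rw [hmat, Matrix.det_submatrix_equiv_self]
  exact hdet

/-- The x↔y mirror: **face rows × ALL columns, conditional on GENERIC NONSINGULARITY** — rows the face
`[W₀, W₀ ⊔ T]`, columns any injective family `w` of `2^κ` sets. -/
theorem partitionMinor_hit_of_face_genericNonsingular (hh : 2 ≤ h) {κ : ℕ} (H : GenericNonsingular h κ)
    (w : (Fin κ → Bool) → Finset (Fin h)) (hw : Function.Injective w)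
    (T : Fin κ ↪ Fin h) (W₀ : Finset (Fin h)) (hW₀ : ∀ c, T c ∉ W₀) :
    ∃ f ∈ SmallCircuits ℂ (h + h) 5,
      (Matrix.of fun i j : Fin κ → Bool => MvPolynomial.coeff
        (∑ a ∈ W₀ ∪ (univ.filter fun c => i c).map T, Finsupp.single (Fin.castAdd h a) 1 +
          ∑ c ∈ w j, Finsupp.single (Fin.natAdd h c) 1) f).det ≠ 0 :=
  partitionMinor_hit_symm h 5 (fun i : Fin κ → Bool => W₀ ∪ (univ.filter fun c => i c).map T) w
    (partitionMinor_hit_face_of_genericNonsingular hh H w hw T W₀ hW₀)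

end

end Summit.ValiantsHypothesis.ValiantsHypothesis.Theorems.BarrierLever.SubsetSum
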